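import Summits.CriticalPhenomena.PercolationContinuityZ3.Theorems.Transplant.KNCells2ChainAdv
import Summits.CriticalPhenomena.PercolationContinuityZ3.Theorems.Transplant.PlanarCellsDefs
import HarnessLib

/-!
# Design (D), (R): the PLANAR ROOT RUN — the straight-run schedule (`ChainPlanar.Adv`, standard) from the first-hop row above the wired root
# cube `C.Q 0` through the between-box `C.Btw 0 du` into the child's cube, ending on a face inside `C.M (0 + du)`: its admissibility (`AdvOK`)
# and the three planar facts of `rootOblA_concG` (KNCellsBoxProdZ2ConcRoot) — every region inside `C.Btw 0 du ∪ C.Q (0 + du)` and off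
# `C.Q 0`, the far face inside `C.M (0 + du)`

builds on p205010 (kernel theorem, internal audit signed; external expert review pending) — nothing in this file uses p205010.
Lane `prim-bschramm`, seat `prim-bschramm-p2` (owner split 15:02:43Z: (R) = p2); helper file (`--supports stmt-CriticalPhenomena-4575`).  Pure `Site 2` geometry.

Parameters (unit `t = r/4`): axis `du.1`, sign `sgOf du`, centre `rootCtr du ca cb` (level `ca`, transverse `cb`), start core = ONE row
(`q = 0`) of half-width `q'` (it carries the landing piece of p3-g2's first hop), advance `s₁ = t`, `nA = 44` advance steps (far face at level
`ca + 45t`), region half-width `ρ = q' + 2t + 47R'` (the least `AdvOK` allows).  `RootRunOK`: `r = 4t`, `R' + ℓ₀ ≤ t`, `2R' ≤ t`, `0 ≤ q'`,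
`q' + 22t + 47R' + 1 ≤ ca`, `23t ≤ ca ≤ 47t` (region 0's bottom `ca - ρ` above `C.Q 0`, far face inside `[68t, 92t]`), `|cb| + q' + 2t + 47R' ≤ 20t` (regions inside the
between-box transversally), `|cb| + q' + t + 46R' ≤ 12t` (far face inside `C.M`).  (With the first hop at scale `ℓ_R = 6t` from a seed row
`20t - ψ - 1`: `ca = 26t - ψ - 1`, `q' = 3t`, `cb = 0` — admissible iff `ψ + 47R' + 2 ≤ t`.)
* `rootRun_advOK`, **`rootRun_region_subset`**, **`rootRun_region_disjoint_Q`**, **`rootRun_last_subset_M`**, `mem_rootCore_zero`.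
[cite: KozmaNitzan2024, §4 p. 28 ((32) at the root), Lemma 11 (pp. 22–23)]
-/

noncomputable section

namespace Summit.CriticalPhenomena.PercolationContinuityZ3.Theorems

namespace Transplant

namespace BoxProdZ2

open Literature.Probability.Percolation Literature.Probability.LatticeModels
open Literature.Probability.Percolation.KozmaNitzan
open Literature.Probability.Percolation.KozmaNitzan.Cells (oth oth_ne eq_oth_of_ne sgOf sgOf_sign stepVec_apply_fst stepVec_apply_oth)
open ChainPlanar

/-- The centre of the root run of direction `du`: level `ca` along the axis (in signed coordinates), transverse coordinate `cb`. [folklore] -/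
def rootCtr (du : MDir) (ca cb : ℤ) : Site 2 := fun i => if i = du.1 then sgOf du * ca else cb

/-- The region half-width of the root run. [folklore] -/
def rootρ (t R' : ℕ) (q' : ℤ) : ℤ := q' + 2 * t + 47 * R'

/-- **Admissible parameters of the root run.** [this work] -/
structure RootRunOK (C : PCells) (t R' ℓ₀ : ℕ) (ca cb q' : ℤ) : Prop where
  /-- the planar unit -/
  hr : (C.r : ℤ) = 4 * t
  /-- route scales fit in one advance -/
  hs : (R' : ℤ) + ℓ₀ ≤ t
  /-- the neighbourhood radius is small -/
  hs2 : 2 * (R' : ℤ) ≤ t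
  /-- the start row has a nonnegative half-width -/
  hq' : 0 ≤ q'
  /-- region `0` stays above the wired root cube -/
  hlo : q' + 22 * t + 47 * R' + 1 ≤ ca
  /-- the far face reaches `C.M (0 + du)` -/
  hlo' : 23 * (t : ℤ) ≤ ca
  /-- the far face stays inside `C.M (0 + du)` -/
  hhi : ca ≤ 47 * t
  /-- the regions stay inside the between-box transversally -/
  htr : |cb| + q' + 2 * t + 47 * R' ≤ 20 * t
  /-- the far face stays inside `C.M (0 + du)` transversally -/
  htrM : |cb| + q' + t + 46 * R' ≤ 12 * t

variable {C : PCells} {du : MDir} {t R' ℓ₀ : ℕ} {ca cb q' : ℤ} (h : RootRunOK C t R' ℓ₀ ca cb q')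
include h

omit h in
/-- The centre along the axis. [folklore] -/
@[simp] theorem rootCtr_fst : rootCtr du ca cb du.1 = sgOf du * ca := by simp [rootCtr]

omit h in
/-- The centre across the axis. [folklore] -/
@[simp] theorem rootCtr_oth : rootCtr du ca cb (oth du.1) = cb := by simp [rootCtr, oth_ne]

/-- **The root run is an admissible straight run** (`q = 0`, `s₁ = t`, `ρ = q' + 2t + 47R'`, `nA = 44`). [cite: KozmaNitzan2024, §4 Lemma 11] -/
theorem rootRun_advOK : Adv.AdvOK 0 q' t (rootρ t R' q') R' ℓ₀ 44 where
  hq := le_rfl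
  hq' := h.hq'
  hs := h.hs
  hs2 := h.hs2
  hρ0 := by unfold rootρ; have := h.hq'; push_cast; linarith
  hρ := by unfold rootρ; push_cast; linarith

omit h in
/-- Signed level arithmetic: `σ (x - σ ca) = σ x - ca`. [folklore] -/
theorem sg_mul_sub (du : MDir) (x ca : ℤ) : sgOf du * (x - sgOf du * ca) = sgOf du * x - ca := by
  have hσσ : sgOf du * sgOf du = 1 := by rcases sgOf_sign du with h | h <;> simp [h]
  calc sgOf du * (x - sgOf du * ca) = sgOf du * x - sgOf du * sgOf du * ca := by ring
    _ = sgOf du * x - ca := by rw [hσσ, one_mul]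

omit h in
/-- The centre of the root cell is the origin. [folklore] -/
theorem cen_zero_apply (i : Fin 2) : C.cen 0 i = 0 := by simp [PCells.cen_apply]

/-- **Every region of the root run lies in `C.Btw 0 du ∪ C.Q (0 + du)`** (`k ≤ 44`). [cite: KozmaNitzan2024, §4 p. 26 (E_{v,x}), Lemma 11 (p. 22: Ω)] -/
theorem rootRun_region_subset {k : ℕ} (hk : k ≤ 44) :
    Adv.region 0 (t : ℤ) (rootρ t R' q') du.1 (sgOf du) (rootCtr du ca cb) k ⊆ C.Btw 0 du ∪ C.Q ((0 : Site 2) + stepVec du) := by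
  intro x hx
  have hx' := Adv.region_subset_prism (sgOf_sign du) (rootCtr du ca cb) (rootRun_advOK h) hk hx
  rw [PCells.mem_psBox_iff] at hx'
  simp only [rootCtr_fst, rootCtr_oth, sg_mul_sub] at hx'
  obtain ⟨⟨hl1, hl2⟩, hb1, hb2⟩ := hx'
  have hr := h.hr; have hlo := h.hlo; have hhi := h.hhi; have htr := h.htr; have hq' := h.hq'
  have hR0 : (0 : ℤ) ≤ R' := by positivity
  unfold rootρ at hl1 hb1 hb2
  push_cast at hl1 hl2 hb1 hb2
  have hcb := le_abs_self cb
  have hcb' := neg_abs_le cb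
  by_cases hL : sgOf du * x du.1 ≤ 15 * (C.r : ℤ) - 1
  · -- the between-box
    refine Finset.mem_union_left _ ?_
    rw [PCells.Btw, PCells.mem_psBox_iff]
    simp only [cen_zero_apply, sub_zero]
    refine ⟨⟨by linarith, hL⟩, by linarith, by linarith⟩
  · -- the child's cube
    refine Finset.mem_union_right _ ?_
    rw [PCells.Q, PCells.mem_sq_iff]
    intro i
    by_cases hi : i = du.1
    · subst hi
      rw [zero_add]
      simp only [PCells.cen_apply]
      push_cast
      rcases sgOf_sign du with hs | hs
      · have e1 : (stepVec du) du.1 = 1 := by rw [stepVec_apply_fst, hs]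
        rw [hs] at hL hl1 hl2
        simp only [one_mul] at hL hl1 hl2
        rw [e1]; constructor <;> linarith
      · have e1 : (stepVec du) du.1 = -1 := by rw [stepVec_apply_fst, hs]
        rw [hs] at hL hl1 hl2
        rw [e1]; constructor <;> linarith
    · rw [eq_oth_of_ne hi, zero_add]
      simp only [PCells.cen_apply, stepVec_apply_oth, mul_zero]
      push_cast
      constructor <;> linarith

/-- **Every region of the root run is off the root cube `C.Q 0`** (`k ≤ 44`): its levels exceed `5r = 20t`. [cite: KozmaNitzan2024, §4 p. 28] -/
theorem rootRun_region_disjoint_Q {k : ℕ} (hk : k ≤ 44) :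
    Disjoint (Adv.region 0 (t : ℤ) (rootρ t R' q') du.1 (sgOf du) (rootCtr du ca cb) k) (C.Q 0) := by
  rw [Finset.disjoint_left]
  intro x hx hxQ
  have hx' := Adv.region_subset_prism (sgOf_sign du) (rootCtr du ca cb) (rootRun_advOK h) hk hx
  rw [PCells.mem_psBox_iff] at hx'
  simp only [rootCtr_fst, rootCtr_oth, sg_mul_sub] at hx'
  obtain ⟨⟨hl1, -⟩, -, -⟩ := hx'
  have hr := h.hr; have hlo := h.hlo; have hq' := h.hq'
  have hR0 : (0 : ℤ) ≤ R' := by positivity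
  unfold rootρ at hl1
  rw [PCells.Q, PCells.mem_sq_iff] at hxQ
  obtain ⟨h1, h2⟩ := hxQ du.1
  simp only [cen_zero_apply] at h1 h2
  push_cast at h1 h2
  rcases sgOf_sign du with hs | hs <;> rw [hs] at hl1 <;> linarith

/-- **The far face of the root run lies in `C.M (0 + du)`.** [cite: KozmaNitzan2024, §4 p. 26 (M_v)] -/
theorem rootRun_last_subset_M :
    Adv.core 0 q' (t : ℤ) R' du.1 (sgOf du) (rootCtr du ca cb) (44 + 1) ⊆ C.M ((0 : Site 2) + stepVec du) := by
  intro x hx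
  rw [(Adv.core_zero_last (q := (0 : ℤ)) (q' := q') (s₁ := (t : ℤ)) (R' := R') (N := 44) (a := du.1) (σ := sgOf du)
    (c := rootCtr du ca cb)).2, PCells.mem_psBox_iff] at hx
  simp only [rootCtr_fst, rootCtr_oth, sg_mul_sub] at hx
  obtain ⟨⟨hl1, hl2⟩, hb1, hb2⟩ := hx
  have hr := h.hr; have hlo := h.hlo'; have hhi := h.hhi; have htrM := h.htrM; have hq' := h.hq'
  have hR0 : (0 : ℤ) ≤ R' := by positivity
  unfold Adv.w₁ at hb1 hb2
  push_cast at hl1 hl2 hb1 hb2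
  have hcb := le_abs_self cb
  have hcb' := neg_abs_le cb
  rw [PCells.M, PCells.mem_sq_iff]
  intro i
  by_cases hi : i = du.1
  · subst hi
    rw [zero_add]
    simp only [PCells.cen_apply]
    push_cast
    rcases sgOf_sign du with hs | hs
    · have e1 : (stepVec du) du.1 = 1 := by rw [stepVec_apply_fst, hs]
      rw [hs] at hl1 hl2
      simp only [one_mul] at hl1 hl2
      rw [e1]; constructor <;> linarith
    · have e1 : (stepVec du) du.1 = -1 := by rw [stepVec_apply_fst, hs]
      rw [hs] at hl1 hl2
      rw [e1]; constructor <;> linarith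
  · rw [eq_oth_of_ne hi, zero_add]
    simp only [PCells.cen_apply, stepVec_apply_oth, mul_zero]
    push_cast
    constructor <;> linarith

omit h in
/-- **Membership in the start row** `core 0 = {level = ca, |trans - cb| ≤ q'}` (for p3-g2's first-hop piece). [folklore] -/
theorem mem_rootCore_zero {x : Site 2} :
    x ∈ Adv.core 0 q' (t : ℤ) R' du.1 (sgOf du) (rootCtr du ca cb) 0 ↔
      sgOf du * x du.1 = ca ∧ cb - q' ≤ x (oth du.1) ∧ x (oth du.1) ≤ cb + q' := by
  rw [(Adv.core_zero_last (q := (0 : ℤ)) (q' := q') (s₁ := (t : ℤ)) (R' := R') (N := 44) (a := du.1) (σ := sgOf du)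
    (c := rootCtr du ca cb)).1, PCells.mem_psBox_iff]
  simp only [rootCtr_fst, rootCtr_oth, sg_mul_sub, neg_zero]
  constructor
  · rintro ⟨⟨h1, h2⟩, h3, h4⟩; exact ⟨by linarith, h3, h4⟩
  · rintro ⟨h1, h3, h4⟩; exact ⟨⟨by linarith, by linarith⟩, h3, h4⟩

end BoxProdZ2

end Transplant

end Summit.CriticalPhenomena.PercolationContinuityZ3.Theorems

end
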